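import Mathlib.Analysis.SpecialFunctions.Gaussian.FourierTransform
import Mathlib.MeasureTheory.Measure.Lebesgue.EqHaar
import HarnessLib

/-!
# (B-ST) flat model, the GAUGE TAIL: the resampling Gaussian leaves the core window with probability `≤ C_E·e^{−u²/(2s²)}`
# (lane A of S-BASE, crux `TwistedTraceScaling` stmt-QuantumFields-20203, C4-CORE, the (B-ST) pen; hand C `…-w3`; the `ε_S` smallness hypothesis of ✓`…BOStiffFlatModel.flat_model`)

The only non-elementary quantity in the slack of ✓`flat_model` / ✓`flat_model_selfNormalised` is the gauge tail fraction
`T(u,s,r) = (∫_{u<‖z‖≤r} e^{−‖z‖²/s²} dz)/(∫_{‖z‖≤r} e^{−‖z‖²/s²} dz)` on a finite-dimensional real inner-product space `E` (the gauge modes, width `s = β⁻¹`, core radius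
`u = (1−ρ)r/2 ≫ s`).  ★★ `gaugeTail_le`: for `0 < s ≤ r`, `0 ≤ u`:  `T ≤ (e·(2π)^{d/2}/vol(B₁))·e^{−u²/(2s²)}`, `d = dim E`, `B₁` the unit ball — numerator: halve the precision
(`𝟙[‖z‖>u]e^{−‖z‖²/s²} ≤ e^{−u²/(2s²)}e^{−‖z‖²/(2s²)}`, Gaussian mass `(2πs²)^{d/2}`, ✓`GaussianFourier.integral_rexp_neg_mul_sq_norm`); denominator: `≥ e^{−1}·vol(B_s) = e^{−1}s^d·vol(B₁)`
(✓`Measure.addHaar_real_closedBall`).  Hence `T → 0` whenever `u/s → ∞` (in the (B-ST) chain `u/s = β^{1/2}ℓ(1−ρ)/2`).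
HONEST FRAMING: classical Gaussian bookkeeping for a stub of a child of the CONDITIONAL route R2b1; (B-ST) OPEN; C4-CORE OPEN; not infinite volume, not a gap, not Clay.

## References
* G. B. Folland, *Real Analysis*, 2nd ed., Wiley 1999, §2.6 (Gaussian integrals on `ℝ^n`). [Folland1999]
-/

set_option autoImplicit false

noncomputable section

open MeasureTheory Filter Metric
open scoped Real

namespace Summit.QuantumFields.YangMills.Theorems.FemtoTransferGap.Mehler

variable {E : Type*} [NormedAddCommGroup E] [InnerProductSpace ℝ E] [FiniteDimensional ℝ E] [MeasurableSpace E] [BorelSpace E]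

/-- The Gaussian `e^{−‖z‖²/s²}` is integrable on `E` and dominated by the half-precision Gaussian, whose mass is `(2πs²)^{d/2}`. [cite: Folland1999, §2.6] -/
theorem gaussian_window_integrable {s : ℝ} (hs : 0 < s) :
    Integrable (fun z : E => Real.exp (-(1 / (2 * s ^ 2)) * ‖z‖ ^ 2)) ∧
    ∫ z : E, Real.exp (-(1 / (2 * s ^ 2)) * ‖z‖ ^ 2) = (π / (1 / (2 * s ^ 2))) ^ (Module.finrank ℝ E / 2 : ℝ) ∧
    Integrable (fun z : E => Real.exp (-(‖z‖ ^ 2 / s ^ 2))) ∧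
    ∀ z : E, Real.exp (-(‖z‖ ^ 2 / s ^ 2)) ≤ Real.exp (-(1 / (2 * s ^ 2)) * ‖z‖ ^ 2) := by
  have hb : 0 < 1 / (2 * s ^ 2) := by positivity
  have hI : ∫ z : E, Real.exp (-(1 / (2 * s ^ 2)) * ‖z‖ ^ 2) = (π / (1 / (2 * s ^ 2))) ^ (Module.finrank ℝ E / 2 : ℝ) :=
    GaussianFourier.integral_rexp_neg_mul_sq_norm hb
  have hIpos : 0 < (π / (1 / (2 * s ^ 2))) ^ (Module.finrank ℝ E / 2 : ℝ) := Real.rpow_pos_of_pos (by positivity) _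
  have hInt : Integrable (fun z : E => Real.exp (-(1 / (2 * s ^ 2)) * ‖z‖ ^ 2)) := Integrable.of_integral_ne_zero (by rw [hI]; exact hIpos.ne')
  have hle : ∀ z : E, Real.exp (-(‖z‖ ^ 2 / s ^ 2)) ≤ Real.exp (-(1 / (2 * s ^ 2)) * ‖z‖ ^ 2) := fun z => by
    refine Real.exp_le_exp.2 ?_
    have h0 : 0 ≤ ‖z‖ ^ 2 / s ^ 2 := by positivity
    have e : -(1 / (2 * s ^ 2)) * ‖z‖ ^ 2 = -(‖z‖ ^ 2 / s ^ 2) / 2 := by field_simp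
    rw [e]; linarith
  have hfi : Integrable (fun z : E => Real.exp (-(‖z‖ ^ 2 / s ^ 2))) :=
    hInt.mono' (Real.continuous_exp.comp ((continuous_norm.pow 2).div_const _).neg).aestronglyMeasurable
      (ae_of_all _ fun z => by rw [Real.norm_eq_abs, abs_of_pos (Real.exp_pos _)]; exact hle z)
  exact ⟨hInt, hI, hfi, hle⟩

/-- ★★ **THE GAUGE TAIL.**  For `0 < s ≤ r`, `0 ≤ u` on a `d`-dimensional real inner-product space `E` with Lebesgue measure:
`(∫_{u<‖z‖≤r} e^{−‖z‖²/s²})/(∫_{‖z‖≤r} e^{−‖z‖²/s²}) ≤ (e·(2π)^{d/2}/vol(B₁))·e^{−u²/(2s²)}`. [cite: Folland1999, §2.6] -/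
theorem gaugeTail_le {s u r : ℝ} (hs : 0 < s) (hsr : s ≤ r) (hu : 0 ≤ u) :
    (∫ z in (closedBall (0 : E) u)ᶜ ∩ closedBall (0 : E) r, Real.exp (-(‖z‖ ^ 2 / s ^ 2))) / (∫ z in closedBall (0 : E) r, Real.exp (-(‖z‖ ^ 2 / s ^ 2))) ≤
      (Real.exp 1 * (2 * π) ^ (Module.finrank ℝ E / 2 : ℝ) / (volume (ball (0 : E) 1)).toReal) * Real.exp (-(u ^ 2 / (2 * s ^ 2))) := by
  obtain ⟨hInt, hI, hfi, hle⟩ := gaussian_window_integrable (E := E) hs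
  have hf0 : ∀ z : E, 0 ≤ Real.exp (-(‖z‖ ^ 2 / s ^ 2)) := fun z => (Real.exp_pos _).le
  -- numerator
  have hnum : ∫ z in (closedBall (0 : E) u)ᶜ ∩ closedBall (0 : E) r, Real.exp (-(‖z‖ ^ 2 / s ^ 2)) ≤
      Real.exp (-(u ^ 2 / (2 * s ^ 2))) * (π / (1 / (2 * s ^ 2))) ^ (Module.finrank ℝ E / 2 : ℝ) := by
    have h1 : ∫ z in (closedBall (0 : E) u)ᶜ ∩ closedBall (0 : E) r, Real.exp (-(‖z‖ ^ 2 / s ^ 2)) ≤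
        ∫ z in (closedBall (0 : E) u)ᶜ, Real.exp (-(‖z‖ ^ 2 / s ^ 2)) :=
      setIntegral_mono_set hfi.integrableOn (ae_of_all _ hf0) (ae_of_all _ Set.inter_subset_left)
    have h2 : ∫ z in (closedBall (0 : E) u)ᶜ, Real.exp (-(‖z‖ ^ 2 / s ^ 2)) ≤
        ∫ z in (closedBall (0 : E) u)ᶜ, Real.exp (-(u ^ 2 / (2 * s ^ 2))) * Real.exp (-(1 / (2 * s ^ 2)) * ‖z‖ ^ 2) := by
      refine setIntegral_mono_on hfi.integrableOn (hInt.const_mul _).integrableOn isClosed_closedBall.measurableSet.compl fun z hz => ?_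
      rw [← Real.exp_add]
      refine Real.exp_le_exp.2 ?_
      rw [Set.mem_compl_iff, mem_closedBall, dist_zero_right, not_le] at hz
      have hz2 : u ^ 2 ≤ ‖z‖ ^ 2 := pow_le_pow_left₀ hu hz.le 2
      have e : -(‖z‖ ^ 2 / s ^ 2) = -(‖z‖ ^ 2 / (2 * s ^ 2)) + -(1 / (2 * s ^ 2)) * ‖z‖ ^ 2 := by field_simp; ring
      rw [e]
      have h3 : u ^ 2 / (2 * s ^ 2) ≤ ‖z‖ ^ 2 / (2 * s ^ 2) := div_le_div_of_nonneg_right hz2 (by positivity)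
      linarith
    have h3 : ∫ z in (closedBall (0 : E) u)ᶜ, Real.exp (-(u ^ 2 / (2 * s ^ 2))) * Real.exp (-(1 / (2 * s ^ 2)) * ‖z‖ ^ 2) ≤
        ∫ z, Real.exp (-(u ^ 2 / (2 * s ^ 2))) * Real.exp (-(1 / (2 * s ^ 2)) * ‖z‖ ^ 2) :=
      setIntegral_le_integral (hInt.const_mul _) (ae_of_all _ fun z => mul_nonneg (Real.exp_pos _).le (Real.exp_pos _).le)
    have h4 : ∫ z : E, Real.exp (-(u ^ 2 / (2 * s ^ 2))) * Real.exp (-(1 / (2 * s ^ 2)) * ‖z‖ ^ 2) =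
        Real.exp (-(u ^ 2 / (2 * s ^ 2))) * (π / (1 / (2 * s ^ 2))) ^ (Module.finrank ℝ E / 2 : ℝ) := by
      rw [integral_const_mul, hI]
    exact h1.trans (h2.trans (h3.trans_eq h4))
  -- denominator
  have hvol : (volume (closedBall (0 : E) s)).toReal = s ^ Module.finrank ℝ E * (volume (ball (0 : E) 1)).toReal := by
    have h := Measure.addHaar_real_closedBall (volume : Measure E) (0 : E) hs.le
    simpa only [measureReal_def] using h
  have hv1 : 0 < (volume (ball (0 : E) 1)).toReal :=
    ENNReal.toReal_pos (measure_ball_pos volume (0 : E) one_pos).ne' measure_ball_lt_top.ne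
  have hvs : 0 < (volume (closedBall (0 : E) s)).toReal := by rw [hvol]; positivity
  have hfin_s : volume (closedBall (0 : E) s) < ⊤ := measure_closedBall_lt_top
  have hden : Real.exp (-1) * (volume (closedBall (0 : E) s)).toReal ≤ ∫ z in closedBall (0 : E) r, Real.exp (-(‖z‖ ^ 2 / s ^ 2)) := by
    have h1 : Real.exp (-1) * (volume (closedBall (0 : E) s)).toReal = ∫ z in closedBall (0 : E) s, Real.exp (-1) := by
      rw [setIntegral_const, smul_eq_mul, mul_comm, measureReal_def]
    have h2 : ∫ z in closedBall (0 : E) s, Real.exp (-1) ≤ ∫ z in closedBall (0 : E) s, Real.exp (-(‖z‖ ^ 2 / s ^ 2)) := by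
      haveI : IsFiniteMeasure ((volume : Measure E).restrict (closedBall (0 : E) s)) := isFiniteMeasure_restrict.2 hfin_s.ne
      refine setIntegral_mono_on (integrable_const _) hfi.integrableOn isClosed_closedBall.measurableSet fun z hz => ?_
      refine Real.exp_le_exp.2 (neg_le_neg ?_)
      rw [mem_closedBall, dist_zero_right] at hz
      rw [div_le_one (by positivity)]
      exact pow_le_pow_left₀ (norm_nonneg _) hz 2
    have h3 : ∫ z in closedBall (0 : E) s, Real.exp (-(‖z‖ ^ 2 / s ^ 2)) ≤ ∫ z in closedBall (0 : E) r, Real.exp (-(‖z‖ ^ 2 / s ^ 2)) :=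
      setIntegral_mono_set hfi.integrableOn (ae_of_all _ hf0) (ae_of_all _ (closedBall_subset_closedBall hsr))
    rw [h1]; exact h2.trans h3
  have hden_pos : 0 < ∫ z in closedBall (0 : E) r, Real.exp (-(‖z‖ ^ 2 / s ^ 2)) := lt_of_lt_of_le (mul_pos (Real.exp_pos _) hvs) hden
  -- the constant
  have e1 : (π / (1 / (2 * s ^ 2))) ^ (Module.finrank ℝ E / 2 : ℝ) = (2 * π) ^ (Module.finrank ℝ E / 2 : ℝ) * s ^ Module.finrank ℝ E := by
    rw [show π / (1 / (2 * s ^ 2)) = (2 * π) * s ^ 2 by field_simp, Real.mul_rpow (by positivity) (by positivity)]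
    congr 1
    rw [show (s ^ 2 : ℝ) = s ^ (2 : ℝ) by norm_cast, ← Real.rpow_mul hs.le, show (2 : ℝ) * (Module.finrank ℝ E / 2 : ℝ) = (Module.finrank ℝ E : ℝ) by ring,
      Real.rpow_natCast]
  rw [div_le_iff₀ hden_pos]
  calc ∫ z in (closedBall (0 : E) u)ᶜ ∩ closedBall (0 : E) r, Real.exp (-(‖z‖ ^ 2 / s ^ 2))
      ≤ Real.exp (-(u ^ 2 / (2 * s ^ 2))) * ((2 * π) ^ (Module.finrank ℝ E / 2 : ℝ) * s ^ Module.finrank ℝ E) := by rw [← e1]; exact hnum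
    _ = (Real.exp 1 * (2 * π) ^ (Module.finrank ℝ E / 2 : ℝ) / (volume (ball (0 : E) 1)).toReal) * Real.exp (-(u ^ 2 / (2 * s ^ 2))) *
          (Real.exp (-1) * (volume (closedBall (0 : E) s)).toReal) := by
        rw [hvol]
        have hee : Real.exp 1 * Real.exp (-1) = 1 := by rw [← Real.exp_add]; norm_num
        have e2 : (Real.exp 1 * (2 * π) ^ (Module.finrank ℝ E / 2 : ℝ) / (volume (ball (0 : E) 1)).toReal) * Real.exp (-(u ^ 2 / (2 * s ^ 2))) *
            (Real.exp (-1) * (s ^ Module.finrank ℝ E * (volume (ball (0 : E) 1)).toReal)) =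
            (Real.exp 1 * Real.exp (-1)) * ((volume (ball (0 : E) 1)).toReal / (volume (ball (0 : E) 1)).toReal) *
              (Real.exp (-(u ^ 2 / (2 * s ^ 2))) * ((2 * π) ^ (Module.finrank ℝ E / 2 : ℝ) * s ^ Module.finrank ℝ E)) := by ring
        rw [e2, hee, div_self hv1.ne', one_mul, one_mul]
    _ ≤ (Real.exp 1 * (2 * π) ^ (Module.finrank ℝ E / 2 : ℝ) / (volume (ball (0 : E) 1)).toReal) * Real.exp (-(u ^ 2 / (2 * s ^ 2))) *
          ∫ z in closedBall (0 : E) r, Real.exp (-(‖z‖ ^ 2 / s ^ 2)) :=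
        mul_le_mul_of_nonneg_left hden (by positivity)

end Summit.QuantumFields.YangMills.Theorems.FemtoTransferGap.Mehler

end
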